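import Summits.AtomisticToContinuum.HydrodynamicLimit.Theorems.DiffuseBackwardInfluence.Negative.TransferKernels
import Literature.Analysis.FluidPDE.HardSphereAlexander

/-!
# `DiffuseBackwardInfluence`: which window hypotheses are load-bearing
(negative knowledge / load-bearing analysis for crux stmt-AtomisticToContinuum-12950, disprover cycle 2)

From the standing disprover's `Cruxes/DiffuseBackwardInfluence/Disproof.lean` (findings F1, F3). Two results on
the three window hypotheses `Δ_N > 0`, `Δ_N → 0`, `Δ_N (N+1)^{1/3} → ∞` of the crux:

* `dbiWithoutPos_of_diffuseBackwardInfluence` — **the positivity hypothesis `∀ N, 0 < Δ N` is redundant**: the crux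
  implies its own strengthening with that hypothesis deleted (eventual positivity follows from the growth hypothesis,
  and `Tendsto` ignores finitely many `N`; the converse implication is trivial). Provers may drop it.
* `dbiWithoutGrowth_false_of` — **the growth hypothesis `Δ_N (N+1)^{1/3} → ∞` is load-bearing**: the crux with it
  deleted (`DBIWithoutGrowth`, windows shorter than the mean free time allowed) is FALSE, proved modulo two named
  standard hypotheses that are not yet theorems of the tree — invariance of the homogeneous canonical law under the
  flow (`EqInvariantH`, the routes' `GibbsInvariance` stmt-9239) and the tagged-sphere collision-intensity bound
  under that law (`IdleIntensityH`, CIP 1994 App. 4.A). Witness: constant profiles, the Alexander flow (a theorem of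
  the tree), `Δ_N = (N+1)^{-1/3}(N+1)^{-1}`, `t = 1`: by the landed pointwise bound `ipr ≥ 9 × idle fraction`
  (`nine_mul_idleFrac_le_ipr`) and invariance, `E[ipr] ≥ 9 (1 − C/(N+1)) → 9 ≠ 0`.
-/

namespace Summit.AtomisticToContinuum.HydrodynamicLimit.Theorems.DiffuseBackwardInfluenceNeg

open scoped BigOperators Topology ENNReal InnerProductSpace
open Filter Set MeasureTheory
open Literature.Analysis.FluidPDE Literature.MathematicalPhysics.KineticTheory
open Summit.AtomisticToContinuum.HydrodynamicLimit.Theses.CollisionIsometryCLT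

noncomputable section

/-! ## §1 (F1) The positivity hypothesis on the window is redundant -/

/-- The crux with the hypothesis `∀ N, 0 < Δ N` deleted (a formally STRONGER statement). -/
def DBIWithoutPos : Prop :=
  ∀ (a₀ θ₀ : T3 → ℝ) (u₀ : T3 → V3), Continuous a₀ → Continuous θ₀ → Continuous u₀ →
    (∀ x, 0 < a₀ x) → (∀ x, 0 < θ₀ x) →
    ∃ σ₀ : ℝ, 0 < σ₀ ∧ ∀ σ : ℝ, 0 < σ → σ < σ₀ →
      ∀ Φ : (N : ℕ) → HardSphereFlow (Torus.geometry (Fin 3)) (hsDiameter σ N) (N + 1),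
      ∀ Δ : ℕ → ℝ, Tendsto Δ atTop (𝓝 0) →
        Tendsto (fun N : ℕ => Δ N * ((N + 1 : ℕ) : ℝ) ^ ((1 : ℝ) / 3)) atTop atTop →
        ∀ t : ℝ, 0 < t →
          Tendsto (fun N : ℕ => ∫⁻ z, ENNReal.ofReal (ipr σ N ((Φ N).flow (t - Δ N) z) (Δ N))
            ∂(localGibbsLaw σ a₀ u₀ θ₀ N (Φ N))) atTop (𝓝 0)

/-- Growth of `Δ_N (N+1)^{1/3}` forces `Δ_N > 0` eventually. [folklore] -/
theorem eventually_pos_of_growth {Δ : ℕ → ℝ}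
    (hg : Tendsto (fun N : ℕ => Δ N * ((N + 1 : ℕ) : ℝ) ^ ((1 : ℝ) / 3)) atTop atTop) :
    ∀ᶠ N in atTop, 0 < Δ N := by
  filter_upwards [hg.eventually_ge_atTop 1] with N hN
  have hp : 0 < ((N + 1 : ℕ) : ℝ) ^ ((1 : ℝ) / 3) := Real.rpow_pos_of_pos (by positivity) _
  by_contra hle
  have : Δ N * ((N + 1 : ℕ) : ℝ) ^ ((1 : ℝ) / 3) ≤ 0 := mul_nonpos_of_nonpos_of_nonneg (not_lt.1 hle) hp.le
  linarith

/-- **F1: the positivity hypothesis is redundant.** The crux implies its version without `∀ N, 0 < Δ N`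
(replace the finitely many non-positive `Δ N` by `1`; `Tendsto` only sees the tail). The converse is trivial, so
the two statements are equivalent; only this direction is recorded here. [folklore] -/
theorem dbiWithoutPos_of_diffuseBackwardInfluence (h : DiffuseBackwardInfluence) : DBIWithoutPos := by
  change (∀ (a₀ θ₀ : T3 → ℝ) (u₀ : T3 → V3), Continuous a₀ → Continuous θ₀ → Continuous u₀ →
        (∀ x, 0 < a₀ x) → (∀ x, 0 < θ₀ x) →
        ∃ σ₀ : ℝ, 0 < σ₀ ∧ ∀ σ : ℝ, 0 < σ → σ < σ₀ →
          ∀ Φ : (N : ℕ) → HardSphereFlow (Torus.geometry (Fin 3)) (hsDiameter σ N) (N + 1),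
          ∀ Δ : ℕ → ℝ, (∀ N, 0 < Δ N) → Tendsto Δ atTop (𝓝 0) →
            Tendsto (fun N : ℕ => Δ N * ((N + 1 : ℕ) : ℝ) ^ ((1 : ℝ) / 3)) atTop atTop →
            ∀ t : ℝ, 0 < t →
              Tendsto (fun N : ℕ => ∫⁻ z, ENNReal.ofReal (ipr σ N ((Φ N).flow (t - Δ N) z) (Δ N))
                ∂(localGibbsLaw σ a₀ u₀ θ₀ N (Φ N))) atTop (𝓝 0)) at h
  intro a₀ θ₀ u₀ ha hθ hu ha0 hθ0
  obtain ⟨σ₀, hσ₀, hσ⟩ := h a₀ θ₀ u₀ ha hθ hu ha0 hθ0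
  refine ⟨σ₀, hσ₀, fun σ hσp hσlt Φ Δ hΔ0 hΔg t ht => ?_⟩
  have hpos := eventually_pos_of_growth hΔg
  set Δ' : ℕ → ℝ := fun N => if 0 < Δ N then Δ N else 1 with hΔ'def
  have hΔ'pos : ∀ N, 0 < Δ' N := by
    intro N
    simp only [hΔ'def]
    split_ifs with h
    · exact h
    · exact one_pos
  have heq : ∀ᶠ N in atTop, Δ' N = Δ N := by
    filter_upwards [hpos] with N hN
    simp only [hΔ'def, if_pos hN]
  have h0' : Tendsto Δ' atTop (𝓝 0) := hΔ0.congr' (heq.mono fun N hN => hN.symm)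
  have hg' : Tendsto (fun N : ℕ => Δ' N * ((N + 1 : ℕ) : ℝ) ^ ((1 : ℝ) / 3)) atTop atTop :=
    hΔg.congr' (heq.mono fun N hN => by simp only [hN])
  have key := hσ σ hσp hσlt Φ Δ' hΔ'pos h0' hg' t ht
  exact key.congr' (heq.mono fun N hN => by simp only [hN])

/-! ## §2 (F3) The growth hypothesis is load-bearing (modulo two named standard hypotheses) -/

/-- The crux with the growth hypothesis `Δ_N (N+1)^{1/3} → ∞` deleted (windows shorter than the mean free time are
then admissible). -/
def DBIWithoutGrowth : Prop :=
  ∀ (a₀ θ₀ : T3 → ℝ) (u₀ : T3 → V3), Continuous a₀ → Continuous θ₀ → Continuous u₀ →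
    (∀ x, 0 < a₀ x) → (∀ x, 0 < θ₀ x) →
    ∃ σ₀ : ℝ, 0 < σ₀ ∧ ∀ σ : ℝ, 0 < σ → σ < σ₀ →
      ∀ Φ : (N : ℕ) → HardSphereFlow (Torus.geometry (Fin 3)) (hsDiameter σ N) (N + 1),
      ∀ Δ : ℕ → ℝ, (∀ N, 0 < Δ N) → Tendsto Δ atTop (𝓝 0) →
        ∀ t : ℝ, 0 < t →
          Tendsto (fun N : ℕ => ∫⁻ z, ENNReal.ofReal (ipr σ N ((Φ N).flow (t - Δ N) z) (Δ N))
            ∂(localGibbsLaw σ a₀ u₀ θ₀ N (Φ N))) atTop (𝓝 0)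

/-- The homogeneous canonical Gibbs law at rest with unit temperature: `localGibbsLaw` with constant profiles
`(1, 0, 1)`. -/
def eqLaw (σ : ℝ) (N : ℕ)
    (Φ : HardSphereFlow (Torus.geometry (Fin 3)) (hsDiameter σ N) (N + 1)) : Measure (Cfg N) :=
  localGibbsLaw σ (fun _ => 1) (fun _ => 0) (fun _ => 1) N Φ

/-- HYPOTHESIS `EqInvariant` (the routes' support item `GibbsInvariance`, stmt-AtomisticToContinuum-9239, at unit
temperature): the homogeneous canonical law is invariant under every flow map (Liouville + energy conservation;
provable now, candidate proofs attached to 9239). -/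
def EqInvariantH (σ : ℝ) : Prop :=
  ∀ (N : ℕ) (Φ : HardSphereFlow (Torus.geometry (Fin 3)) (hsDiameter σ N) (N + 1)) (s : ℝ),
    MeasurePreserving (Φ.flow s) (eqLaw σ N Φ) (eqLaw σ N Φ)

/-- HYPOTHESIS (tagged-sphere collision intensity, in the form used): under the homogeneous canonical law the
expected idle fraction over a window of length `Δ ≤ 1` is at least `1 − C (N+1)^{1/3} Δ` — a tagged sphere of
diameter `σ (N+1)^{-1/3}` among `N + 1` expects `≤ C σ² (N+1)^{1/3} Δ` collisions in `[0, Δ]` (special-flow /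
flux representation of the collision intensity, [cite: CIP1994, App. 4.A]; contact value bounded at `σ < 1/2`).
Not in the tree. -/
def IdleIntensityH (σ : ℝ) : Prop :=
  ∃ C : ℝ, ∀ (N : ℕ) (Φ : HardSphereFlow (Torus.geometry (Fin 3)) (hsDiameter σ N) (N + 1)) (Δ : ℝ),
    0 < Δ → Δ ≤ 1 →
      ENNReal.ofReal (1 - C * ((N + 1 : ℕ) : ℝ) ^ ((1 : ℝ) / 3) * Δ) ≤
        ∫⁻ y, ENNReal.ofReal (idleFrac σ N y Δ) ∂(eqLaw σ N Φ)

/-- **F3 (load-bearing hypothesis): `DBIWithoutGrowth` is false**, modulo `EqInvariantH` and `IdleIntensityH` on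
`(0, 1/2)`. Witness: constant profiles `(1, 0, 1)`, the Alexander flow (`HardSphereFlow.nonempty_torus_holds`), the
sub-mean-free-time window `Δ_N = ((N+1)^{1/3})⁻¹ (N+1)⁻¹` (`> 0`, `→ 0`, but `Δ_N (N+1)^{1/3} = (N+1)⁻¹`), `t = 1`:
by `nine_mul_idleFrac_le_ipr`, `lintegral_map_le` and invariance, `E[ipr ∘ Φ_{1−Δ_N}] ≥ 9 E_G[idleFrac] ≥
9 (1 − C/(N+1)) → 9`, contradicting `→ 0`. Any proof of the crux must therefore use the growth hypothesis. -/
theorem dbiWithoutGrowth_false_of (hinv : ∀ σ : ℝ, 0 < σ → σ < 1 / 2 → EqInvariantH σ)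
    (hidle : ∀ σ : ℝ, 0 < σ → σ < 1 / 2 → IdleIntensityH σ) : ¬ DBIWithoutGrowth := by
  intro h
  obtain ⟨σ₀, hσ₀, hσ⟩ := h (fun _ => 1) (fun _ => 1) (fun _ => 0) continuous_const continuous_const
    continuous_const (fun _ => one_pos) (fun _ => one_pos)
  -- a reduced density below both thresholds
  set σ : ℝ := min (σ₀ / 2) (1 / 4) with hσdef
  have hσp : 0 < σ := lt_min (by linarith) (by norm_num)
  have hσlt : σ < σ₀ := (min_le_left _ _).trans_lt (by linarith)
  have hσh : σ < 1 / 2 := (min_le_right _ _).trans_lt (by norm_num)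
  -- the Alexander flow (Alexander's theorem is a theorem of the tree)
  have hflow : ∀ N : ℕ, Nonempty (HardSphereFlow (Torus.geometry (Fin 3)) (hsDiameter σ N) (N + 1)) :=
    fun N => HardSphereFlow.nonempty_torus_holds (d := Fin 3) (hsDiameter_pos hσp N)
      ((hsDiameter_le hσp.le N).trans_lt (by rw [inv_eq_one_div]; exact hσh)) (N + 1)
  let Φ : (N : ℕ) → HardSphereFlow (Torus.geometry (Fin 3)) (hsDiameter σ N) (N + 1) :=
    fun N => (hflow N).some
  obtain ⟨C', hC⟩ := hidle σ hσp hσh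
  -- the sub-mean-free-time window Δ_N = (N+1)^{-1/3} (N+1)^{-1}
  have hr : ∀ N : ℕ, 1 ≤ ((N + 1 : ℕ) : ℝ) ^ ((1 : ℝ) / 3) := fun N =>
    Real.one_le_rpow (by exact_mod_cast Nat.succ_pos N) (by norm_num)
  have hrpos : ∀ N : ℕ, 0 < ((N + 1 : ℕ) : ℝ) ^ ((1 : ℝ) / 3) := fun N => one_pos.trans_le (hr N)
  let Δ : ℕ → ℝ := fun N => (((N + 1 : ℕ) : ℝ) ^ ((1 : ℝ) / 3))⁻¹ * (1 / ((N : ℝ) + 1))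
  have hN1 : ∀ N : ℕ, (0 : ℝ) < (N : ℝ) + 1 := fun N => by positivity
  have hΔp : ∀ N : ℕ, 0 < Δ N := fun N => mul_pos (inv_pos.2 (hrpos N)) (one_div_pos.2 (hN1 N))
  have hΔle : ∀ N : ℕ, Δ N ≤ 1 / ((N : ℝ) + 1) := fun N => by
    have h1 : (((N + 1 : ℕ) : ℝ) ^ ((1 : ℝ) / 3))⁻¹ ≤ 1 := inv_le_one_of_one_le₀ (hr N)
    calc Δ N = (((N + 1 : ℕ) : ℝ) ^ ((1 : ℝ) / 3))⁻¹ * (1 / ((N : ℝ) + 1)) := rfl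
      _ ≤ 1 * (1 / ((N : ℝ) + 1)) := mul_le_mul_of_nonneg_right h1 (one_div_pos.2 (hN1 N)).le
      _ = 1 / ((N : ℝ) + 1) := one_mul _
  have hΔle1 : ∀ N : ℕ, Δ N ≤ 1 := fun N => (hΔle N).trans (by
    rw [div_le_one (hN1 N)]; linarith [(Nat.cast_nonneg N : (0 : ℝ) ≤ N)])
  have hΔ0 : Tendsto Δ atTop (𝓝 0) :=
    tendsto_of_tendsto_of_tendsto_of_le_of_le tendsto_const_nhds tendsto_one_div_add_atTop_nhds_zero_nat
      (fun N => (hΔp N).le) hΔle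
  have hrΔ : ∀ N : ℕ, C' * ((N + 1 : ℕ) : ℝ) ^ ((1 : ℝ) / 3) * Δ N = C' * (1 / ((N : ℝ) + 1)) := by
    intro N
    show C' * ((N + 1 : ℕ) : ℝ) ^ ((1 : ℝ) / 3) *
        ((((N + 1 : ℕ) : ℝ) ^ ((1 : ℝ) / 3))⁻¹ * (1 / ((N : ℝ) + 1))) = C' * (1 / ((N : ℝ) + 1))
    rw [← mul_assoc, mul_assoc C', mul_inv_cancel₀ (hrpos N).ne', mul_one]
  -- the crux without growth, applied
  have hT := hσ σ hσp hσlt Φ Δ hΔp hΔ0 1 one_pos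
  -- lower bound: E[ipr ∘ Φ_{1-Δ}] ≥ 9 E_G[idleFrac] ≥ 9 (1 - C'/(N+1))
  have hlow : ∀ N : ℕ, 9 * ENNReal.ofReal (1 - C' * (1 / ((N : ℝ) + 1))) ≤
      ∫⁻ z, ENNReal.ofReal (ipr σ N ((Φ N).flow (1 - Δ N) z) (Δ N))
        ∂(localGibbsLaw σ (fun _ => 1) (fun _ => 0) (fun _ => 1) N (Φ N)) := by
    intro N
    have hmap : Measure.map ((Φ N).flow (1 - Δ N)) (eqLaw σ N (Φ N)) = eqLaw σ N (Φ N) :=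
      (hinv σ hσp hσh N (Φ N) (1 - Δ N)).map_eq
    have h1 : 9 * ENNReal.ofReal (1 - C' * (1 / ((N : ℝ) + 1))) ≤
        9 * ∫⁻ y, ENNReal.ofReal (idleFrac σ N y (Δ N)) ∂(eqLaw σ N (Φ N)) := by
      have h0 := hC N (Φ N) (Δ N) (hΔp N) (hΔle1 N)
      rw [hrΔ N] at h0
      gcongr
    have h2 : 9 * ∫⁻ y, ENNReal.ofReal (idleFrac σ N y (Δ N)) ∂(eqLaw σ N (Φ N)) =
        ∫⁻ y, ENNReal.ofReal (9 * idleFrac σ N y (Δ N)) ∂(eqLaw σ N (Φ N)) := by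
      rw [← lintegral_const_mul' _ _ (by norm_num : (9 : ℝ≥0∞) ≠ ∞)]
      refine lintegral_congr fun y => ?_
      rw [show (9 : ℝ≥0∞) = ENNReal.ofReal 9 by norm_num, ← ENNReal.ofReal_mul (by norm_num)]
    have h3 : ∫⁻ y, ENNReal.ofReal (9 * idleFrac σ N y (Δ N)) ∂(eqLaw σ N (Φ N)) ≤
        ∫⁻ z, ENNReal.ofReal (9 * idleFrac σ N ((Φ N).flow (1 - Δ N) z) (Δ N)) ∂(eqLaw σ N (Φ N)) := by
      conv_lhs => rw [← hmap]
      exact lintegral_map_le _ _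
    have h4 : ∫⁻ z, ENNReal.ofReal (9 * idleFrac σ N ((Φ N).flow (1 - Δ N) z) (Δ N)) ∂(eqLaw σ N (Φ N)) ≤
        ∫⁻ z, ENNReal.ofReal (ipr σ N ((Φ N).flow (1 - Δ N) z) (Δ N)) ∂(eqLaw σ N (Φ N)) :=
      lintegral_mono fun z => ENNReal.ofReal_le_ofReal (nine_mul_idleFrac_le_ipr _ _ _ _)
    exact h1.trans (h2.le.trans (h3.trans h4))
  -- the lower bound tends to 9
  have hlim : Tendsto (fun N : ℕ => 9 * ENNReal.ofReal (1 - C' * (1 / ((N : ℝ) + 1)))) atTop (𝓝 9) := by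
    have h1 : Tendsto (fun N : ℕ => 1 - C' * (1 / ((N : ℝ) + 1))) atTop (𝓝 1) := by
      have := (tendsto_one_div_add_atTop_nhds_zero_nat.const_mul C').const_sub 1
      simpa using this
    have h2 : Tendsto (fun N : ℕ => ENNReal.ofReal (1 - C' * (1 / ((N : ℝ) + 1)))) atTop (𝓝 1) := by
      have := ENNReal.tendsto_ofReal h1
      rwa [ENNReal.ofReal_one] at this
    have h3 := ENNReal.Tendsto.const_mul h2 (Or.inl one_ne_zero) (a := 9)
    simpa using h3
  have h9 : (9 : ℝ≥0∞) ≤ 0 := le_of_tendsto_of_tendsto hlim hT (Eventually.of_forall hlow)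
  exact absurd h9 (by norm_num)

end

end Summit.AtomisticToContinuum.HydrodynamicLimit.Theorems.DiffuseBackwardInfluenceNeg
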